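import Summits.HodgeConjecture.HodgeConjecture.Theorems.F0P3cDyRamShellLabelPlus          -- ★ p854835 (this seat): `pairing_xPlus_mulVec`, `v_inv_varpi_pow_mul_le_one_iff`; brings ★ №3 Pieces, ★ `F0P3cDyRamPiecesShellLemmas`, ★ `WildQuadraticDatumRefSkewScalar`, ★ `UnitaryThreeSingularUnipotentClasses`
import Literature.NumberTheory.LocalFields.WildQuadraticDatumNormSurjective                 -- ★ p854729 (LH4-p02 (g12)): `exists_mul_map_eq_of_isRamifiedQuadraticDatum` (Serre V §3 Cor. 3: one-units of level `2d` are norms)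
import Literature.NumberTheory.Automorphic.UnitaryThreeLevelTwoCongruence                   -- ★ `isIntMatrix_upperUnipotent` (cited, not restated)
import HarnessLib

/-!
# Crux `H413`, line LH4 «(D-RAM) FOUR-FRAME», tier 2 under `U4_Rows` §2 (iv-a)·T3: THE DIAGONAL WITNESSES — the reference transvections `1 + ε·X₊` of BOTH
# norm classes and an INTEGRAL regular unipotent, with their shell ∕ label ∕ regularity facts (generic valued field with an involutive isometry; sheet datum)

Cell `hodgecm-mathlib` (D-0151), FLOOR 0, crux item H413 = `stmt-HodgeConjecture-24833`, route of record `HCCMUnconditional`; squad F0∕P3c∕LH4, Track A; dealer LH4-plan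
(g10) WORD #17∕#18 (U4 §2 T3 `stub_U4_table_diag_ne_zero` → LH4-p03); tier-2 hand LH4-p03 (g11).  THEOREMS ONLY (no `def`, no instance, no notation, no `sorry`, default
heartbeats); lane `--supports stmt-HodgeConjecture-24833 --as helper`.

THE MATHEMATICS.  `Φ₃ = antidiag(1,1,1)`, `t₊ = (ϖ − σϖ)·((ϖσϖ)^{⌊d∕2⌋})⁻¹` the coefficient of ★ `xPlus` (skew, `|t₊| = exp(−ℓ₀)`, `ℓ₀ = d % 2`, ★ `v_refSkewScalar`).
(§1) `n(εt₊) − 1 = ε • xPlus`; for a unit `ε` the scaled nilpotent is on the same shell (`NearTransvShell ϖ ℓ₀ m`); `⟨y, (ε•X₊)y⟩ = ε·t₊·N(y₂)`; `xPlus` has `NormClassPlus`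
(`y = y′ = e₂`, `z = 1`), and `ε • xPlus` has NOT when `ε` is not a norm (`εt₊N(y₂) = t₊N(y′₂)N(z) ≠ 0 ⇒ ε = N(y′₂z∕y₂)`).  (§2) **The class-`−` reference is not label `+`
at the level of record `m* = ℓ₀ + 2d − 1`**: `LabelPlus` would put `t₊` (the value of `X₊` at `e₂`) in the value set of `ε•X₊` mod `ϖ^{m*}`, i.e. `|t₊|·|1 − εN(y₂)| ≤ exp(−m*)`,
`|1 − εN(y₂)| ≤ exp(−(2d−1))`; `u = εN(y₂)` is `σ`-fixed, so `|u − 1|` is EVEN (sheet datum) hence `≤ exp(−2d) = |ϖ|^{2d}`, and ★ `exists_mul_map_eq_of_isRamifiedQuadraticDatum`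
([Serre1979] V §3 Cor. 3, the sharp lower numbering of the ramified quadratic extension) makes `u` a NORM — so `ε = N(z∕y₂)`, contradiction.  (§3) The integral regular
unipotent `u(a, b) = (1, a, b; 0, 1, −σa; 0, 0, 1)`, `b + σb + aσa = 0` (★ `mem_unitaryGroupOfForm_iff_of_coe_eq_upperUnipotent`): `(u − 1)² = −N(a)·E₀₂` (★
`upperUnipotent_sub_one_mul_self`), so `(u−1)² ∉ ϖ^m M₃(𝒪)` as soon as `|N(a)| > exp(−m)`, `(u−1)³ = 0`; with `a = ϖ^k`, `2k = d − ℓ₀`, the trace image ★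
`exists_integral_add_map_eq` supplies an INTEGRAL `b`, and `2k = d − ℓ₀ < m*`; `u(a,b)` and `u(a,b)⁻¹ = (1, −a, −aσa − b; 0, 1, σa; 0, 0, 1)` are integral.

* §1 `corner_sub_one_eq_smul_xPlus`, `inLevel_smul_iff`, `nearTransvShell_smul_xPlus`, `pairing_smul_xPlus_mulVec`, `normClassPlus_xPlus`, `not_normClassPlus_smul_xPlus`,
  `isIntMatrix_corner`.
* §2 **`not_labelPlus_smul_xPlus`**.
* §3 `not_inLevel_upper_sub_one_sq`, `upper_sub_one_pow_three`, `isIntMatrix_upper_inv` (with ★ `isIntMatrix_upperUnipotent`), **`exists_regular_entries`**.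

HONEST LABEL.  Count-neutral helper (no stub paid here; the T3 payer assembles these witnesses with the positivity of admissible orbital measures).  (D-RAM) verdict of
record PRINT [LanglandsShelstad1989 Thm. p. 484 ∕ Rogawski1990 Prop. 4.9.1 (a)] ∕ XL; `HC_CM` is proved only modulo the 7 printed citations (2 remaining: hLiu418 =
`stmt-HodgeConjecture-24832`, h413 = `stmt-HodgeConjecture-24833`) until rung 0 closes.
-/

noncomputable section

namespace Summit.HodgeConjecture.HodgeConjecture.Cruxes.H413.F0P3cDyRamTableDiagWitnesses

open Literature.NumberTheory.Automorphic Literature.NumberTheory.Automorphic.UnitaryGroup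
open Literature.NumberTheory.Automorphic.UnitaryLatticeTree Literature.NumberTheory.Automorphic.HermitianLattice
open Literature.NumberTheory.Automorphic.UnitaryThreeFourFrame
open Literature.NumberTheory.LocalFields.WildQuadraticDatum
open Summit.HodgeConjecture.HodgeConjecture.Cruxes.H413.F0P3cDyRamFourFramePieces
open Summit.HodgeConjecture.HodgeConjecture.Cruxes.H413.F0P3cDyRamFourFrameUnipotentLabelDefs
open Summit.HodgeConjecture.HodgeConjecture.Cruxes.H413.F0P3cDyRamPiecesShellLemmas
open Summit.HodgeConjecture.HodgeConjecture.Cruxes.H413.F0P3cDyRamShellLabelPlus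
open scoped Matrix MatrixGroups Valued
open WithZero

variable {K : Type} [Field K] [Valued K ℤᵐ⁰]

/-! ## §1  The two reference transvections `n(ε·t₊)`, `ε ∈ {1, non-norm unit}` -/

omit [Valued K ℤᵐ⁰] in
/-- `n(ε·t₊) − 1 = ε • xPlus σ ϖ d`. -/
theorem corner_sub_one_eq_smul_xPlus (σ : K →+* K) (ϖ ε : K) (d : ℕ) :
    (!![1, 0, ε * ((ϖ - σ ϖ) * ((ϖ * σ ϖ) ^ ((d - d % 2) / 2))⁻¹); 0, 1, 0; 0, 0, 1] : Matrix (Fin 3) (Fin 3) K) - 1 = ε • xPlus σ ϖ d := by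
  ext i j
  fin_cases i <;> fin_cases j <;> simp [xPlus_apply]

/-- Scaling by a unit does not change the level of a matrix. -/
theorem inLevel_smul_iff {ε : K} (hε : Valued.v ε = 1) (ϖ : K) (n : ℕ) (X : Matrix (Fin 3) (Fin 3) K) :
    InLevel ϖ n (ε • X) ↔ InLevel ϖ n X := by
  refine forall_congr' fun a => forall_congr' fun b => ?_
  rw [Matrix.smul_apply, smul_eq_mul, mul_left_comm, map_mul, hε, one_mul]

/-- **`ε • xPlus` is on the shell of depth `ℓ₀ = d % 2` at every level** when `|ε| = 1` (★ `nearTransvShell_xPlus` rescaled). -/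
theorem nearTransvShell_smul_xPlus {σ : K →+* K} (hvσ : ∀ a, Valued.v (σ a) = Valued.v a) {ϖ : K} (hϖ : Valued.v ϖ = exp (-1 : ℤ)) {d : ℕ}
    (hd : Valued.v (ϖ - σ ϖ) = Valued.v ϖ ^ d) {ε : K} (hε : Valued.v ε = 1) (m : ℕ) :
    NearTransvShell ϖ (d % 2) m (ε • xPlus σ ϖ d) := by
  obtain ⟨h1, h2, -⟩ := nearTransvShell_xPlus hvσ hϖ hd m
  refine ⟨(inLevel_smul_iff hε ϖ _ _).2 h1, fun h => h2 ((inLevel_smul_iff hε ϖ _ _).1 h), ?_⟩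
  rw [Matrix.smul_mul, Matrix.mul_smul, xPlus_mul_xPlus, smul_zero, smul_zero]
  exact inLevel_zero ϖ m

omit [Valued K ℤᵐ⁰] in
/-- `⟨y, (ε • X₊) y⟩ = ε·t₊·(y₂·σ y₂)`. -/
theorem pairing_smul_xPlus_mulVec (σ : K →+* K) (ϖ ε : K) (d : ℕ) (y : Fin 3 → K) :
    pairing σ ((StdForm.antidiagonal 3).over K) y ((ε • xPlus σ ϖ d).mulVec y) =
      ε * ((ϖ - σ ϖ) * ((ϖ * σ ϖ) ^ ((d - d % 2) / 2))⁻¹ * (y 2 * σ (y 2))) := by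
  rw [Matrix.smul_mulVec, map_smul, smul_eq_mul, pairing_xPlus_mulVec]

omit [Valued K ℤᵐ⁰] in
/-- **`xPlus` has `NormClassPlus`** (`y = y′ = e₂`, `z = 1`), as soon as `t₊ ≠ 0`. -/
theorem normClassPlus_xPlus (σ : K →+* K) {ϖ : K} {d : ℕ} (ht : (ϖ - σ ϖ) * ((ϖ * σ ϖ) ^ ((d - d % 2) / 2))⁻¹ ≠ 0) :
    NormClassPlus σ ϖ d (xPlus σ ϖ d) := by
  refine ⟨Pi.single 2 1, Pi.single 2 1, 1, ?_, ?_⟩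
  · rw [pairing_xPlus_mulVec, Pi.single_eq_same, map_one, mul_one, mul_one]; exact ht
  · rw [pairing_xPlus_mulVec, Pi.single_eq_same, map_one, mul_one, mul_one, mul_one]

omit [Valued K ℤᵐ⁰] in
/-- **`ε • xPlus` has NOT `NormClassPlus` when `ε` is not a norm**: `ε·t₊·N(y₂) = t₊·N(y′₂)·N(z) ≠ 0` forces `ε = N(y′₂·z∕y₂)`. -/
theorem not_normClassPlus_smul_xPlus (σ : K →+* K) (ϖ : K) (d : ℕ) {ε : K} (hε : ∀ z : K, z * σ z ≠ ε) :
    ¬ NormClassPlus σ ϖ d (ε • xPlus σ ϖ d) := by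
  rintro ⟨y, y', z, hne, heq⟩
  rw [pairing_smul_xPlus_mulVec] at hne heq
  rw [pairing_xPlus_mulVec] at heq
  obtain ⟨tp, htp⟩ : ∃ tp : K, (ϖ - σ ϖ) * ((ϖ * σ ϖ) ^ ((d - d % 2) / 2))⁻¹ = tp := ⟨_, rfl⟩
  rw [htp] at hne heq
  have htp0 : tp ≠ 0 := fun h => hne (by rw [h, zero_mul, mul_zero])
  have hy : y 2 ≠ 0 := fun h => hne (by rw [h, zero_mul, mul_zero, mul_zero])
  have hσy : σ (y 2) ≠ 0 := (map_ne_zero σ).2 hy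
  have hN : y 2 * σ (y 2) ≠ 0 := mul_ne_zero hy hσy
  have key : ε * (y 2 * σ (y 2)) = (y' 2 * σ (y' 2)) * (z * σ z) :=
    mul_left_cancel₀ htp0 (by linear_combination heq)
  refine hε (y' 2 * z * (y 2)⁻¹) ?_
  rw [map_mul, map_mul, map_inv₀]
  calc y' 2 * z * (y 2)⁻¹ * (σ (y' 2) * σ z * (σ (y 2))⁻¹)
      = (y' 2 * σ (y' 2)) * (z * σ z) * (y 2 * σ (y 2))⁻¹ := by rw [mul_inv]; ring
    _ = ε * (y 2 * σ (y 2)) * (y 2 * σ (y 2))⁻¹ := by rw [key]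
    _ = ε := mul_inv_cancel_right₀ hN ε

/-- `n(e)` and `n(e)⁻¹ = n(−e)` are integral matrices when `|e| ≤ 1` (★ `isIntMatrix_upperUnipotent` at `a = c = 0`). -/
theorem isIntMatrix_corner {e : K} (he : Valued.v e ≤ 1) :
    IsIntMatrix (!![1, 0, e; 0, 1, 0; 0, 0, 1] : Matrix (Fin 3) (Fin 3) K) ∧ IsIntMatrix (!![1, 0, -e; 0, 1, 0; 0, 0, 1] : Matrix (Fin 3) (Fin 3) K) := by
  have h0 : Valued.v (0 : K) ≤ 1 := by rw [map_zero]; exact zero_le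
  have he' : Valued.v (-e) ≤ 1 := by rwa [Valuation.map_neg]
  exact ⟨isIntMatrix_upperUnipotent h0 he h0, isIntMatrix_upperUnipotent h0 he' h0⟩

/-! ## §2  The class-`−` reference transvection is not label `+` at the level of record -/

/-- **`¬ LabelPlus σ ϖ d m* (ε • xPlus)`, `m* = d % 2 + 2d − 1`, for a `σ`-FIXED NON-NORM `ε`** over a complete sheet datum `IsRamifiedQuadraticDatum σ ϖ d t`: were the value
sets equal mod `ϖ^{m*}`, the value `t₊` of `X₊` at `e₂` would be `εt₊N(y₂)` up to `ϖ^{m*}𝒪` for an integral `y`, so `|1 − εN(y₂)| ≤ exp(−(2d−1))`; the `σ`-fixed one-unit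
`u = εN(y₂)` then has `|u − 1| ≤ |ϖ|^{2d}` (fixed elements have even valuation) and is a norm by ★ `exists_mul_map_eq_of_isRamifiedQuadraticDatum` — making `ε` a norm.
[cite: Serre1979, Ch. V §3 Cor. 3] -/
theorem not_labelPlus_smul_xPlus [IsAdicComplete 𝓂[K] 𝒪[K]] {σ : K →+* K} {ϖ : K} {d t : ℕ} (hD : IsRamifiedQuadraticDatum σ ϖ d t)
    {ε : K} (hσε : σ ε = ε) (hε : ∀ z : K, z * σ z ≠ ε) :
    ¬ LabelPlus σ ϖ d (d % 2 + 2 * d - 1) (ε • xPlus σ ϖ d) := by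
  obtain ⟨hσσ, hvσ, hϖ, heven, hd, h1d, -⟩ := id hD
  intro hL
  obtain ⟨tp, htpdef⟩ : ∃ tp : K, (ϖ - σ ϖ) * ((ϖ * σ ϖ) ^ ((d - d % 2) / 2))⁻¹ = tp := ⟨_, rfl⟩
  have htp : Valued.v tp = exp (-((d % 2 : ℕ) : ℤ)) := by rw [← htpdef]; exact v_refSkewScalar hvσ hϖ hd
  have htp0 : tp ≠ 0 := by rw [← htpdef]; exact refSkewScalar_ne_zero hvσ hϖ hd
  -- `t₊` is a value of `X₊` at the integral vector `e₂`
  have hmem : tp ∈ valueSetMod σ ϖ (d % 2 + 2 * d - 1) (xPlus σ ϖ d) := by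
    refine ⟨Pi.single 2 1, fun a => ?_, ?_⟩
    · by_cases ha : a = 2
      · subst ha; rw [Pi.single_eq_same, map_one]
      · rw [Pi.single_eq_of_ne ha, map_zero]; exact zero_le
    · rw [pairing_xPlus_mulVec, htpdef, Pi.single_eq_same, map_one, mul_one, mul_one, sub_self, mul_zero, map_zero]
      exact zero_le
  unfold LabelPlus at hL
  rw [← hL] at hmem
  obtain ⟨y, hy, hclose⟩ := hmem
  rw [pairing_smul_xPlus_mulVec, htpdef, v_inv_varpi_pow_mul_le_one_iff hϖ] at hclose
  obtain ⟨u, hudef⟩ : ∃ u : K, ε * (y 2 * σ (y 2)) = u := ⟨_, rfl⟩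
  have hfact : tp - ε * (tp * (y 2 * σ (y 2))) = tp * (1 - u) := by rw [← hudef]; ring
  rw [hfact, map_mul, htp] at hclose
  -- `hclose : exp(−ℓ₀) · |1 − u| ≤ exp(−m*)`; hence `|u − 1| ≤ |ϖ|^{2d}`
  have hσu : σ u = u := by rw [← hudef, map_mul, map_mul, hσε, hσσ, mul_comm (σ (y 2))]
  have hu1 : Valued.v (u - 1) ≤ Valued.v ϖ ^ (2 * d) := by
    rw [v_varpi_pow hϖ, ← Valuation.map_sub_swap]
    by_cases h0 : 1 - u = 0
    · rw [h0, map_zero]; exact zero_le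
    · have hfix : σ (1 - u) = 1 - u := by rw [map_sub, map_one, hσu]
      obtain ⟨n, hn⟩ := heven (1 - u) hfix h0
      rw [hn] at hclose ⊢
      rw [← exp_add, exp_le_exp] at hclose
      rw [exp_le_exp]
      push_cast at hclose ⊢
      omega
  -- so `u` is a norm (sharp norm surjectivity on one-units of level `2d`)
  obtain ⟨z, hz, -⟩ := exists_mul_map_eq_of_isRamifiedQuadraticDatum σ ϖ d t hD u hσu hu1
  -- and `y₂ ≠ 0` (else `u = 0` and `|t₊| ≤ exp(−m*)` with `2d − 1 ≥ 1`)
  have hy2 : y 2 ≠ 0 := by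
    intro h0
    have hu0 : u = 0 := by rw [← hudef, h0, zero_mul, mul_zero]
    rw [hu0, sub_zero, map_one, mul_one, exp_le_exp] at hclose
    push_cast at hclose
    omega
  have hσy2 : σ (y 2) ≠ 0 := (map_ne_zero σ).2 hy2
  have hN : y 2 * σ (y 2) ≠ 0 := mul_ne_zero hy2 hσy2
  refine hε (z * (y 2)⁻¹) ?_
  rw [map_mul, map_inv₀]
  calc z * (y 2)⁻¹ * (σ z * (σ (y 2))⁻¹) = z * σ z * (y 2 * σ (y 2))⁻¹ := by rw [mul_inv]; ring
    _ = ε * (y 2 * σ (y 2)) * (y 2 * σ (y 2))⁻¹ := by rw [hz, hudef]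
    _ = ε := mul_inv_cancel_right₀ hN ε

/-! ## §3  The integral regular unipotent `u(a, b) = (1, a, b; 0, 1, −σa; 0, 0, 1)` -/

/-- **`(u(a,b) − 1)² ∉ ϖ^m M₃(𝒪)` when `|a·σa| > exp(−m)`** (`(u − 1)² = (a·(−σa))·E₀₂`, ★ `upperUnipotent_sub_one_mul_self`). -/
theorem not_inLevel_upper_sub_one_sq (σ : K →+* K) {ϖ : K} (hϖ : Valued.v ϖ = exp (-1 : ℤ)) {m : ℕ} {a : K} (b : K)
    (hlt : exp (-(m : ℤ)) < Valued.v (a * σ a)) :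
    ¬ InLevel ϖ m (((!![1, a, b; 0, 1, -σ a; 0, 0, 1] : Matrix (Fin 3) (Fin 3) K) - 1) * ((!![1, a, b; 0, 1, -σ a; 0, 0, 1] : Matrix (Fin 3) (Fin 3) K) - 1)) := by
  rw [upperUnipotent_sub_one_mul_self]
  intro h
  have h02 := (v_inv_varpi_pow_mul_le_one_iff hϖ m _).1 (h 0 2)
  have e : (!![0, 0, a * -σ a; 0, 0, 0; 0, 0, 0] : Matrix (Fin 3) (Fin 3) K) 0 2 = a * -σ a := rfl
  rw [e, mul_neg, Valuation.map_neg] at h02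
  exact not_le.2 hlt h02

omit [Valued K ℤᵐ⁰] in
/-- `(u(a,b,c) − 1)³ = 0`. -/
theorem upper_sub_one_pow_three (a b c : K) :
    (((!![1, a, b; 0, 1, c; 0, 0, 1] : Matrix (Fin 3) (Fin 3) K) - 1)) ^ 3 = 0 := by
  rw [pow_succ, pow_two, upperUnipotent_sub_one_mul_self]
  ext i j
  fin_cases i <;> fin_cases j <;> simp [Matrix.mul_apply, Fin.sum_univ_three, Matrix.one_apply]

/-- `u(a, b, c)⁻¹ = (1, −a, ac − b; 0, 1, −c; 0, 0, 1)` is an integral matrix when `|a|, |b|, |c| ≤ 1` (★ `isIntMatrix_upperUnipotent`). -/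
theorem isIntMatrix_upper_inv {a b c : K} (ha : Valued.v a ≤ 1) (hb : Valued.v b ≤ 1) (hc : Valued.v c ≤ 1) :
    IsIntMatrix (!![1, -a, a * c - b; 0, 1, -c; 0, 0, 1] : Matrix (Fin 3) (Fin 3) K) := by
  have hacb : Valued.v (a * c - b) ≤ 1 :=
    (Valuation.map_sub _ _ _).trans (max_le (by rw [map_mul]; exact mul_le_one' ha hc) hb)
  have ha' : Valued.v (-a) ≤ 1 := by rwa [Valuation.map_neg]
  have hc' : Valued.v (-c) ≤ 1 := by rwa [Valuation.map_neg]
  exact isIntMatrix_upperUnipotent ha' hacb hc'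

/-- **INTEGRAL REGULAR DATA**: over a sheet datum there are `a, b ∈ 𝒪` with `b + σb + a·σa = 0` and `|a·σa| > exp(−m*)`, `m* = d % 2 + 2d − 1`: take `a = ϖ^k`,
`2k = d − d % 2`, and `b` an integral solution of `b + σb = −N(a)` (★ `exists_integral_add_map_eq`: the trace hits every fixed element of valuation `≤ exp(−2k)` once
`d ≤ 2k + 1`); then `|N(a)| = exp(−(d − ℓ₀)) > exp(−(ℓ₀ + 2d − 1))` as `d ≥ 1`. [cite: Serre1979, Ch. V §3 Lemma 4] -/
theorem exists_regular_entries {σ : K →+* K} {ϖ : K} {d t : ℕ} (hD : IsRamifiedQuadraticDatum σ ϖ d t) :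
    ∃ a b : K, Valued.v a ≤ 1 ∧ Valued.v b ≤ 1 ∧ b + σ b + a * σ a = 0 ∧
      exp (-((d % 2 + 2 * d - 1 : ℕ) : ℤ)) < Valued.v (a * σ a) := by
  obtain ⟨hσσ, hvσ, hϖ, heven, hd, h1d, h2t⟩ := hD
  obtain ⟨k, hkdef⟩ : ∃ k : ℕ, (d - d % 2) / 2 = k := ⟨_, rfl⟩
  have h2k : 2 * k = d - d % 2 := by rw [← hkdef]; exact Nat.mul_div_cancel' (Nat.dvd_sub_mod d)
  have hva : Valued.v (ϖ ^ k) = exp (-(k : ℤ)) := by rw [map_pow, v_varpi_pow hϖ]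
  have hN : Valued.v (ϖ ^ k * σ (ϖ ^ k)) = exp (-(2 * (k : ℤ))) := by
    rw [map_mul, hvσ, hva, ← exp_add]; congr 1; ring
  have hyfix : σ (-(ϖ ^ k * σ (ϖ ^ k))) = -(ϖ ^ k * σ (ϖ ^ k)) := by rw [map_neg, map_mul, hσσ, mul_comm]
  have hvy : Valued.v (-(ϖ ^ k * σ (ϖ ^ k))) ≤ exp (-(2 * (k : ℤ))) := by rw [Valuation.map_neg, hN]
  obtain ⟨b, hb1, hb⟩ := exists_integral_add_map_eq hσσ heven hϖ hd h2t hyfix hvy (by omega)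
  refine ⟨ϖ ^ k, b, ?_, hb1, ?_, ?_⟩
  · rw [hva, ← exp_zero, exp_le_exp]; omega
  · rw [hb]; ring
  · rw [hN, exp_lt_exp]; omega

end Summit.HodgeConjecture.HodgeConjecture.Cruxes.H413.F0P3cDyRamTableDiagWitnesses

end
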